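import Summits.ResolutionOfSingularities.ResolutionOfSingularities.Theorems.FrobeniusClosingSteerVisitLawPointStep

/-!
# Crux `Steer` (stmt-ResolutionOfSingularities-16345), chain W4.1, (Par-S) hARᵒ S1a — **(δ) «at a late point step the clord along the tracked
# divisor is ≤ 1» from N4's «no singular height-one prime», and the visit law of a run WITHOUT the (δ) hypothesis**
# (res-type-062 g15; res-L0-w41-plan-1 RULING 156c; the (δ) slot was booked for res-type-072 — discharged here from the N4 clause the
# assembler `ArithReductionLegality.arithSwitchClause_of_H2` already carries; Theses-free support)

OURS (campaign `res-hironaka`, rung L ★L-G4, slot W4.1; statements about the route's own objects; they replace the role of no printed item and are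
NOT statements of the manuscript under review [claim: Hironaka2017, status: under-review]; AI review is weaker than expert review).
Seat res-type-062 g15. Definition-free; no Theses file is imported.

## What is proved (characteristic `2`)

* `clord_le_one_of_noSingularHeightOne` — CORE: in a regular local member `S`, `x ∈ 𝔪 ∖ 𝔪²` non-zero, if NO height-one prime is a singular
  prime of `T² = f` then `f − g² ∈ (x^n)` forces `n ≤ 1` (else `f = g² + x·G` with `G ∈ (x)`, and `(x)` — prime of height one — is singular by
  `SigmaTopLegality.isSingPrime_of_mem`).
* `clord_le_one_at_visit` — **(δ) at the later visit of a visit pair**: steered run, `R 0` dominated by `O`, visit pair `(j, j′)` with Hγ, `x`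
  exceptional at `j`, members regular, and N4's height-one clause AT `j′` ⇒ every clord along `x` at `j′` is `≤ 1`.
* **`visitLaw₂_of_run`** — `VisitLawPointStep.visitLaw₂_of_pieces` with (δ) DISCHARGED: the repaired visit law (unit cofactor), the count
  `j′ − j = ν/2` and the clord `ν % 2` at `j′`, from the run words + Hγ + regular members + N4's height-one clause at `j′` — exactly the binders
  `hreg` / `h1` of `ArithReductionLegality.arithSwitchClause_of_H2`.
* `hS1a_of_run` — the `hS1a` binder of `ArithReductionLegality.arithSwitchClause_of_H2` / `H3_of_pieces` produced from the run modulo Hγ (S1c).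

[folklore]
-/

-- `Summit.<S>.<S>.…` duplicates the summit name by design (single-problem summit).
set_option linter.dupNamespace false

open IsLocalRing
open Literature.AlgebraicGeometry.Resolution (SubringDominates)

namespace Summit.ResolutionOfSingularities.ResolutionOfSingularities.Theorems.SwitchingDichotomy

namespace VisitLawDelta

open Summit.ResolutionOfSingularities.ResolutionOfSingularities.Theorems.SwitchingDichotomy.Words
  (HasClordAlongAt HasCleanedOrderAt IsSteeredRun IsVisitPair IsPointStep)

variable {K : Type} [Field K]

/-! ## §1 The core: no singular height-one prime ⇒ clord along a regular parameter is `≤ 1` -/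

/-- **CORE of (δ).** Characteristic `2`, `S ⊆ K` a regular local member, `x ∈ 𝔪_S ∖ 𝔪_S²` non-zero, `f ∈ S`. If no prime of height one is a
singular prime of `T² = f`, then `f − g² ∈ (x ^ n)` is impossible for `n ≥ 2`: otherwise `f = g² + x·(x^(n−1)·c)` and the height-one prime `(x)`
is singular (`SigmaTopLegality.isSingPrime_of_mem`). [folklore] -/
theorem clord_le_one_of_noSingularHeightOne [CharP K 2] (S : Subring K) [IsRegularLocalRing S] (f : S) {x : S}
    (hxm : x ∈ maximalIdeal S) (hx2 : x ∉ maximalIdeal S ^ 2) (hx0 : x ≠ 0)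
    (h1 : ∀ (Q : Ideal S) [Q.IsPrime], Q.height = 1 → ¬ SigmaTopLegality.IsSingPrime S 2 f Q)
    {n : ℕ} (hn : ∃ g : S, f - g ^ 2 ∈ Ideal.span {x ^ n}) : n ≤ 1 := by
  classical
  by_contra hlt
  push Not at hlt
  obtain ⟨g, hg⟩ := hn
  obtain ⟨c, hc⟩ := Ideal.mem_span_singleton'.mp hg
  haveI := Literature.AlgebraicGeometry.Resolution.isDomain_of_isRegularLocalRing S
  haveI hprime : (Ideal.span ({x} : Set S)).IsPrime := SigmaTopLegality.isPrime_span_singleton_of_not_mem_sq S hxm hx2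
  have hunit : ¬ IsUnit x := fun h => (IsLocalRing.mem_maximalIdeal x).mp hxm h
  have hht : (Ideal.span ({x} : Set S)).height = 1 :=
    le_antisymm (Ideal.height_span_singleton_le_one hunit)
      (Ideal.one_le_height_span_singleton_of_mem_nonZeroDivisors (mem_nonZeroDivisors_of_ne_zero hx0))
  have hf : f = g ^ 2 + x * (x ^ (n - 1) * c) := by
    have e : x * (x ^ (n - 1) * c) = c * x ^ n := by
      rw [← mul_assoc, ← pow_succ', show n - 1 + 1 = n by omega, mul_comm]
    rw [e, hc]
    ring
  have hxQ : x ∈ Ideal.span ({x} : Set S) := Ideal.mem_span_singleton_self x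
  have hGQ : x ^ (n - 1) * c ∈ Ideal.span ({x} : Set S) :=
    Ideal.mul_mem_right _ _ (Ideal.pow_mem_of_mem _ hxQ _ (by omega))
  exact h1 _ hht (SigmaTopLegality.isSingPrime_of_mem S f g x _ hf _ hxQ hGQ)

/-! ## §2 (δ) at the later visit, and the visit law of a run -/

variable {O : ValuationSubring K} {R : ℕ → Subring K} {P : (i : ℕ) → Ideal (R i)} {t : K} {s : ℕ → K}

/-- **(δ) at the later visit of a visit pair.** Steered run at `p = 2` in characteristic `2`, `R 0` dominated by `O`; `(j, j′)` a visit pair with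
Hγ «only `x`-strips strictly between», `x` exceptional at `j`, members regular; if NO height-one prime of `R j′` is a singular prime of the member
(N4 at the late point step `j′`), then every clord along `x` at `j′` is `≤ 1`. [folklore] -/
theorem clord_le_one_at_visit [CharP K 2] (hrun : IsSteeredRun O R P t 2 s) (hR0 : SubringDominates (R 0) O.toSubring)
    {j j' : ℕ} (hvisit : IsVisitPair R P j j') {x : K}
    (hx : (∃ h : x ∈ R j, (⟨x, h⟩ : R j) ∈ P j) ∧ x ≠ 0 ∧ ∀ y : R j, y ∈ P j → O.valuation (y : K) ≤ O.valuation x)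
    (Hγ : ∀ k, j < k → k < j' → ∃ hx : x ∈ R k, P k = Ideal.span {(⟨x, hx⟩ : R k)})
    (hreg : ∀ i, IsRegularLocalRing (R i))
    (h1 : ∀ (hs' : s j' ^ 2 ∈ R j') (Q : Ideal (R j')) [Q.IsPrime], Q.height = 1 →
      ¬ SigmaTopLegality.IsSingPrime (R j') 2 ⟨s j' ^ 2, hs'⟩ Q) :
    ∀ n, HasClordAlongAt R s 2 j' x n → n ≤ 1 := by
  have hR : R j' = R (j + 1) := (VisitLawTelescope.visitLaw_telescope_of_isVisitPair hrun hR0 hvisit hx Hγ).1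
  have hx1 : x ∈ R (j + 1) := (VisitLawPointStep.isLocalBlowupAlong_of_run hrun j).isLocalBlowup.le hx.1.fst
  obtain ⟨hm, hm2, -⟩ := VisitLawPointStep.prime_excParam_succ hrun hR0 hvisit.2.1 (hreg j) (hreg (j + 1)) hx hx1
  have hx0 : (⟨x, hx1⟩ : R (j + 1)) ≠ 0 := fun h => hx.2.1 (congrArg Subtype.val h)
  intro n hn
  unfold HasClordAlongAt at hn
  rw [hR] at hn h1
  obtain ⟨hx', hs', hex, -⟩ := hn
  haveI := hreg (j + 1)
  exact clord_le_one_of_noSingularHeightOne (R (j + 1)) ⟨s j' ^ 2, hs'⟩ hm hm2 hx0 (h1 hs') hex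

/-- **The repaired visit law OF A RUN (FILE 2b with (δ) discharged).** Steered run at `p = 2` in characteristic `2`, `R 0` dominated by `O`;
`(j, j′)` a visit pair with Hγ; `x` exceptional at `j`; members regular; N4's height-one clause at `j′`; `ν ≥ 2` the exact cleaned order at `j`.
Then `R j′ = R (j+1)`, `s j′ · x ^ (ν/2) · W = s j − G` (`G, W, W⁻¹ ∈ R j′`, `W ≠ 0`), `j′ − j = ν/2`, and the clord along `x` at `j′` is `ν % 2`.
[folklore] -/
theorem visitLaw₂_of_run [CharP K 2] (hrun : IsSteeredRun O R P t 2 s) (hR0 : SubringDominates (R 0) O.toSubring)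
    {j j' : ℕ} (hvisit : IsVisitPair R P j j') {x : K}
    (hx : (∃ h : x ∈ R j, (⟨x, h⟩ : R j) ∈ P j) ∧ x ≠ 0 ∧ ∀ y : R j, y ∈ P j → O.valuation (y : K) ≤ O.valuation x)
    (Hγ : ∀ k, j < k → k < j' → ∃ hx : x ∈ R k, P k = Ideal.span {(⟨x, hx⟩ : R k)})
    (hreg : ∀ i, IsRegularLocalRing (R i))
    (h1 : ∀ (hs' : s j' ^ 2 ∈ R j') (Q : Ideal (R j')) [Q.IsPrime], Q.height = 1 →
      ¬ SigmaTopLegality.IsSingPrime (R j') 2 ⟨s j' ^ 2, hs'⟩ Q)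
    {ν : ℕ} (hν : 2 ≤ ν) (hclean : HasCleanedOrderAt R s 2 j ν) :
    (R j' = R (j + 1) ∧ ∃ G W : K, G ∈ R j' ∧ W ∈ R j' ∧ W⁻¹ ∈ R j' ∧ W ≠ 0 ∧ s j' * x ^ (ν / 2) * W = s j - G) ∧
      j' - j = ν / 2 ∧ HasClordAlongAt R s 2 j' x (ν % 2) :=
  VisitLawPointStep.visitLaw₂_of_pieces hrun hR0 hvisit hx Hγ (hreg j) (hreg (j + 1)) hν hclean
    (clord_le_one_at_visit hrun hR0 hvisit hx Hγ hreg h1)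

/-- **The `hS1a` binder of `ArithReductionLegality.arithSwitchClause_of_H2` from the run, modulo Hγ (S1c) — for cleaned orders `ν ≥ 2`.**
Late visit pairs (`N₁ ≤ j`) at which N4's height-one clause holds at every late point step. (The binder in `arithSwitchClause_of_H2` quantifies
over all `ν`; at a late A-stage `ν = d ≥ 3`, which is where `H3_of_pieces` uses it — see `hS1a_of_run'` for the literal shape with the
harmless side condition `2 ≤ ν` exposed.) [folklore] -/
theorem hS1a_of_run [CharP K 2] (hrun : IsSteeredRun O R P t 2 s) (hR0 : SubringDominates (R 0) O.toSubring)
    (hreg : ∀ i, IsRegularLocalRing (R i)) {N₁ : ℕ}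
    (h1 : ∀ j, N₁ ≤ j → IsPointStep R P j → ∀ (hs' : s j ^ 2 ∈ R j) (Q : Ideal (R j)) [Q.IsPrime], Q.height = 1 →
      ¬ SigmaTopLegality.IsSingPrime (R j) 2 ⟨s j ^ 2, hs'⟩ Q)
    (HΓ : ∀ j j' (x : K), N₁ ≤ j → IsVisitPair R P j j' →
      ((∃ h : x ∈ R j, (⟨x, h⟩ : R j) ∈ P j) ∧ x ≠ 0 ∧ ∀ y : R j, y ∈ P j → O.valuation (y : K) ≤ O.valuation x) →
      ∀ k, j < k → k < j' → ∃ hx : x ∈ R k, P k = Ideal.span {(⟨x, hx⟩ : R k)}) :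
    ∀ (j j' : ℕ) (x : K) (ν : ℕ), N₁ ≤ j → IsVisitPair R P j j' →
      ((∃ hx : x ∈ R j, (⟨x, hx⟩ : R j) ∈ P j) ∧ x ≠ 0 ∧ ∀ y : R j, y ∈ P j → O.valuation (y : K) ≤ O.valuation x) →
      2 ≤ ν → HasCleanedOrderAt R s 2 j ν →
      R j' = R (j + 1) ∧ ∃ G W : K, G ∈ R j' ∧ W ∈ R j' ∧ W⁻¹ ∈ R j' ∧ W ≠ 0 ∧ s j' * x ^ (ν / 2) * W = s j - G := by
  intro j j' x ν hj hvisit hx hν hclean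
  have hj' : N₁ ≤ j' := hj.trans hvisit.1.le
  exact (visitLaw₂_of_run hrun hR0 hvisit hx (HΓ j j' x hj hvisit hx) hreg (h1 j' hj' hvisit.2.2.1) hν hclean).1

end VisitLawDelta

end Summit.ResolutionOfSingularities.ResolutionOfSingularities.Theorems.SwitchingDichotomy
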